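import Literature.Claims.NS.GeorgievDavidi2024
import Mathlib.Analysis.Calculus.BumpFunction.InnerProduct
import Mathlib.Analysis.SpecialFunctions.Trigonometric.Deriv

/-!
# C31b `GeorgievDavidi2024` — refutation of the compactness device p.2979 (`Step_L8_YCompact`), part 1/2:
# the witness sequence in the `B`-ball of `X¹ = C¹([0,∞), C²(ℝ³))`

Cell `ns-claims` (D-0090 NS-CLAIMS SWEEP), claim C31b (Filomat 38:9 (2024) 2965–2982 [GeorgievDavidi2024]);
typed skeleton `Literature.Claims.NS.GeorgievDavidi2024` (p482552, typist-4 g2); lanes refuter-4 · ref-3 g2 ·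
salvage-p1 g2. KIT written by the typist (ns-claims-typist-4 g2, sha16 5346ee3e97005006) for the refuter lane; adopted by the
refuter of record ns-claims-refuter-4 (g0) after an independent farm check, with ONE mechanical edit: the three
generic helper lemmas `one_le_infty`, `infty_add_one_le`, `norm_single_one` made `private` (gate dedup against
unrelated Literature modules); kit otherwise byte-identical — to adopt, re-check and file (conv. (b)); the
VERDICT/REF words are the refuter's/referee's. Locator: p.2979 «Let Ỹ denote the set of all equi-continuous
families in X with respect to the norm ‖·‖. Let also, Y = Ỹ‾, U = {(u,v,w,p) ∈ Y : ‖(u,v,w,p)‖ < B}.» with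
«Note that Y is a compact set in X» and p.2980 «(I − S)(Ū) resides in a compact subset of Y» — the journal twin
of C31's adjudicated device (arXiv v10 p.12; ADJUDICATED #38).

THIS FILE (part 1) transplants the C31 witness machinery (typist-4's kit; the landed C31 engine is refuter-4's
`…Theorems.GeorgievDavidi2021.not_ballCompact`, whose internals are not reused here to keep this file
self-contained) to the whole space-time `[0,∞) × ℝ³`: for `w = (x₀, r > 0, a, R > 0)` the functions
`f w n t x = R · ε n · sin(2π2ⁿ(t − a)) · φ x` (`φ` a smooth bump at `x₀`), their derivatives, joint smoothness,
and — for the instance `w₁ = (0, 1, 0, 1)` — membership `inX1_f` in `X¹` and the bound `x1NormLe_f`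
(`‖f w₁ n‖_{X¹} ≤ 1`, all eight sups over `[0,∞) × ℝ³`). Part 2 (`SoloRefuteGeorgievDavidi2024Device.lean`)
proves the separation and `not_Step_L8_YCompact`.

Closed terms; axioms `propext`, `Classical.choice`, `Quot.sound`.

WHAT THIS IS NOT: not a claim about NS regularity or blow-up; not a claim about any author beyond the
typed locator.
-/

-- The summit's canonical theorem namespace repeats the summit name (single-conjunct summit).
set_option linter.dupNamespace false

noncomputable section

open scoped ContDiff
open Set MeasureTheory

namespace Summit.NavierStokesRegularity.NavierStokesRegularity.Theorems.GeorgievDavidi2024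

open Literature.Claims.NS.GeorgievDavidi2021 (pd)
open Literature.Claims.NS.GeorgievDavidi2024


/-! ## Smoothness-exponent arithmetic and a derivative rule -/

/-- `1 ≤ ∞` in the smoothness-exponent order. -/
private lemma one_le_infty : (1 : WithTop ℕ∞) ≤ ∞ := by exact_mod_cast le_top

/-- `∞ + 1 ≤ ∞` in the smoothness-exponent order. -/
private lemma infty_add_one_le : (∞ : WithTop ℕ∞) + 1 ≤ ∞ := by
  rw [← WithTop.coe_one, ← WithTop.coe_add, top_add]

/-- The coordinate unit vectors have norm `1`. -/
private lemma norm_single_one (k : Fin 3) : ‖EuclideanSpace.single k (1 : ℝ)‖ = 1 := by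
  simp

/-- `∂_k (A·g) = A·∂_k g` for differentiable `g`. -/
lemma pd_const_mul (A : ℝ) {g : EuclideanSpace ℝ (Fin 3) → ℝ} (hg : Differentiable ℝ g) (k : Fin 3)
    (x : EuclideanSpace ℝ (Fin 3)) : pd k (fun y => A * g y) x = A * pd k g x := by
  unfold pd
  rw [((hg x).hasFDerivAt.const_mul A).fderiv]
  rfl

/-- `|∂_k g(x)| ≤ ‖∇g(x)‖`. -/
lemma abs_pd_le_norm_fderiv (g : EuclideanSpace ℝ (Fin 3) → ℝ) (k : Fin 3) (x : EuclideanSpace ℝ (Fin 3)) :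
    |pd k g x| ≤ ‖fderiv ℝ g x‖ := by
  unfold pd
  have := (fderiv ℝ g x).le_opNorm (EuclideanSpace.single k (1 : ℝ))
  rw [norm_single_one, mul_one] at this
  simpa [Real.norm_eq_abs] using this

/-! ## Witness parameters -/

/-- The data of one witness family: a ball `closedBall x₀ r` inside the core, the time interval `[a, a+1]`,
the radius `R` of the norm-ball. -/
structure W where
  /-- centre of the fat part of the core -/
  x₀ : EuclideanSpace ℝ (Fin 3)
  /-- its radius -/
  r : ℝ
  /-- `r > 0` -/
  hr : 0 < r
  /-- left end of the time interval -/
  a : ℝ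
  /-- radius of the norm-ball -/
  R : ℝ
  /-- `R > 0` -/
  hR : 0 < R

variable (w : W)

/-! ## The bump and its derivative bounds -/

/-- A smooth bump at `x₀`: `= 1` on `closedBall x₀ (r/2)`, supported in `ball x₀ (3r/4)`. -/
def bump : ContDiffBump w.x₀ :=
  ⟨w.r / 2, 3 * w.r / 4, by linarith [w.hr], by linarith [w.hr]⟩

/-- The bump as a function `φ`. -/
def φ : EuclideanSpace ℝ (Fin 3) → ℝ := bump w

/-- `φ` is `C^∞`. -/
lemma φ_contDiff : ContDiff ℝ ∞ (φ w) := (bump w).contDiff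

/-- `φ` is `Cⁿ` for every `n : ℕ∞`. -/
lemma φ_contDiff' (n : ℕ∞) : ContDiff ℝ n (φ w) := (bump w).contDiff

/-- `φ` is differentiable. -/
lemma φ_differentiable : Differentiable ℝ (φ w) := (φ_contDiff' w 1).differentiable one_ne_zero

/-- `φ(x₀) = 1`. -/
lemma φ_centre : φ w w.x₀ = 1 :=
  (bump w).one_of_mem_closedBall (Metric.mem_closedBall_self (bump w).rIn_pos.le)

/-- `|φ| ≤ 1`. -/
lemma φ_abs_le_one (x : EuclideanSpace ℝ (Fin 3)) : |φ w x| ≤ 1 := by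
  have h0 : 0 ≤ φ w x := (bump w).nonneg
  have h1 : φ w x ≤ 1 := (bump w).le_one
  rw [abs_of_nonneg h0]
  exact h1

/-- `φ` vanishes off `closedBall x₀ r`. -/
lemma φ_eq_zero {x : EuclideanSpace ℝ (Fin 3)} (hx : x ∉ Metric.closedBall w.x₀ w.r) : φ w x = 0 := by
  have hx' : x ∉ Function.support (bump w : EuclideanSpace ℝ (Fin 3) → ℝ) := by
    rw [(bump w).support_eq]
    intro h
    apply hx
    have h34 : dist x w.x₀ < 3 * w.r / 4 := by simpa [bump] using h
    exact Metric.mem_closedBall.mpr (by linarith [w.hr])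
  have : (bump w : EuclideanSpace ℝ (Fin 3) → ℝ) x = 0 := by simpa [Function.mem_support] using hx'
  simpa [φ] using this

/-- `φ` has compact support. -/
lemma φ_hasCompactSupport : HasCompactSupport (φ w) := (bump w).hasCompactSupport

/-- `∂_k φ` as a function. -/
def dφ (k : Fin 3) : EuclideanSpace ℝ (Fin 3) → ℝ := pd k (φ w)

/-- `∂_k φ` is `C^∞`. -/
lemma dφ_contDiff (k : Fin 3) : ContDiff ℝ ∞ (dφ w k) := by
  unfold dφ pd
  exact ((φ_contDiff w).fderiv_right infty_add_one_le).clm_apply contDiff_const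

/-- `∂_k φ` is `C¹`. -/
lemma dφ_contDiff_one (k : Fin 3) : ContDiff ℝ 1 (dφ w k) := (dφ_contDiff w k).of_le one_le_infty

/-- `∂_k φ` is differentiable. -/
lemma dφ_differentiable (k : Fin 3) : Differentiable ℝ (dφ w k) :=
  (dφ_contDiff_one w k).differentiable one_ne_zero

/-- `∂_k φ` has compact support. -/
lemma dφ_hasCompactSupport (k : Fin 3) : HasCompactSupport (dφ w k) := by
  unfold dφ pd
  exact ((φ_hasCompactSupport w).fderiv (𝕜 := ℝ)).comp_left
    (g := fun L : EuclideanSpace ℝ (Fin 3) →L[ℝ] ℝ => L (EuclideanSpace.single k (1 : ℝ))) (by simp)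

/-- Uniform bound on `‖∇φ‖`. -/
lemma exists_bound_fderiv_φ : ∃ B₁ : ℝ, ∀ x, ‖fderiv ℝ (φ w) x‖ ≤ B₁ :=
  ((φ_hasCompactSupport w).fderiv (𝕜 := ℝ)).exists_bound_of_continuous
    ((φ_contDiff' w 1).continuous_fderiv one_ne_zero)

/-- Uniform bound on `‖∇(∂_k φ)‖`. -/
lemma exists_bound_fderiv_dφ (k : Fin 3) : ∃ B₂ : ℝ, ∀ x, ‖fderiv ℝ (dφ w k) x‖ ≤ B₂ :=
  ((dφ_hasCompactSupport w k).fderiv (𝕜 := ℝ)).exists_bound_of_continuous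
    ((dφ_contDiff_one w k).continuous_fderiv one_ne_zero)

/-! ## Constants -/

/-- The constant `B ≥ 1` dominating all first and pure second partials of `φ`. -/
def B : ℝ :=
  1 + |(exists_bound_fderiv_φ w).choose| + ∑ k : Fin 3, |(exists_bound_fderiv_dφ w k).choose|

/-- `1 ≤ B`. -/
lemma one_le_B : 1 ≤ B w := by
  have h1 : 0 ≤ |(exists_bound_fderiv_φ w).choose| := abs_nonneg _
  have h2 : 0 ≤ ∑ k : Fin 3, |(exists_bound_fderiv_dφ w k).choose| :=
    Finset.sum_nonneg fun k _ => abs_nonneg _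
  unfold B; linarith

/-- `0 < B`. -/
lemma B_pos : 0 < B w := lt_of_lt_of_le one_pos (one_le_B w)

/-- `|∂_k φ| ≤ B`. -/
lemma abs_pd_φ_le (k : Fin 3) (x : EuclideanSpace ℝ (Fin 3)) : |pd k (φ w) x| ≤ B w := by
  have h := abs_pd_le_norm_fderiv (φ w) k x
  have hb := (exists_bound_fderiv_φ w).choose_spec x
  have h2 : 0 ≤ ∑ k : Fin 3, |(exists_bound_fderiv_dφ w k).choose| :=
    Finset.sum_nonneg fun k _ => abs_nonneg _
  have : ‖fderiv ℝ (φ w) x‖ ≤ |(exists_bound_fderiv_φ w).choose| := hb.trans (le_abs_self _)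
  unfold B; linarith

/-- `|∂_k ∂_k φ| ≤ B`. -/
lemma abs_pd_pd_φ_le (k : Fin 3) (x : EuclideanSpace ℝ (Fin 3)) : |pd k (pd k (φ w)) x| ≤ B w := by
  have h := abs_pd_le_norm_fderiv (dφ w k) k x
  have hb := (exists_bound_fderiv_dφ w k).choose_spec x
  have hk : |(exists_bound_fderiv_dφ w k).choose| ≤
      ∑ j : Fin 3, |(exists_bound_fderiv_dφ w j).choose| :=
    Finset.single_le_sum (f := fun j => |(exists_bound_fderiv_dφ w j).choose|) (fun j _ => abs_nonneg _)
      (Finset.mem_univ k)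
  have h1 : 0 ≤ |(exists_bound_fderiv_φ w).choose| := abs_nonneg _
  have : ‖fderiv ℝ (dφ w k) x‖ ≤ |(exists_bound_fderiv_dφ w k).choose| := hb.trans (le_abs_self _)
  change |pd k (dφ w k) x| ≤ B w
  unfold B; linarith

/-- `c = 1/B ∈ (0,1]`. -/
def c : ℝ := 1 / B w

/-- `0 < c`. -/
lemma c_pos : 0 < c w := one_div_pos.mpr (B_pos w)

/-- `c ≤ 1`. -/
lemma c_le_one : c w ≤ 1 := (div_le_one (B_pos w)).mpr (one_le_B w)

/-- `c · B = 1`. -/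
lemma c_mul_B : c w * B w = 1 := by unfold c; field_simp [(B_pos w).ne']

/-- The frequencies `fr n = 2π·2ⁿ`. -/
def fr (n : ℕ) : ℝ := 2 * Real.pi * 2 ^ n

/-- `0 < fr n`. -/
lemma fr_pos (n : ℕ) : 0 < fr n := by unfold fr; positivity

/-- `1 ≤ fr n`. -/
lemma one_le_fr (n : ℕ) : 1 ≤ fr n := by
  unfold fr
  have hπ : 3 < Real.pi := Real.pi_gt_three
  have h2 : (1 : ℝ) ≤ 2 ^ n := one_le_pow₀ (by norm_num)
  nlinarith

/-- The amplitudes `ε n = c / fr n`. -/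
def ε (n : ℕ) : ℝ := c w / fr n

/-- `0 < ε n`. -/
lemma ε_pos (n : ℕ) : 0 < ε w n := div_pos (c_pos w) (fr_pos n)

/-- `ε n ≤ c`. -/
lemma ε_le_c (n : ℕ) : ε w n ≤ c w := div_le_self (c_pos w).le (one_le_fr n)

/-- `ε n · fr n = c`. -/
lemma ε_mul_fr (n : ℕ) : ε w n * fr n = c w := by unfold ε; field_simp [(fr_pos n).ne']

/-- The time factor `amp n t = R · ε n · sin(fr n · (t − a))`. -/
def amp (n : ℕ) (t : ℝ) : ℝ := w.R * ε w n * Real.sin (fr n * (t - w.a))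

/-- `|amp n t| ≤ R ε n`. -/
lemma abs_amp_le (n : ℕ) (t : ℝ) : |amp w n t| ≤ w.R * ε w n := by
  unfold amp
  rw [abs_mul, abs_mul, abs_of_pos w.hR, abs_of_pos (ε_pos w n)]
  exact mul_le_of_le_one_right (mul_pos w.hR (ε_pos w n)).le (Real.abs_sin_le_one _)

/-- The witness: `f n t x = R · ε n · sin(fr n · (t − a)) · φ x`. -/
def f (n : ℕ) (t : ℝ) (x : EuclideanSpace ℝ (Fin 3)) : ℝ := amp w n t * φ w x

/-! ## Derivatives of the witness -/

/-- `∂_k f n(t,·) = amp n t · ∂_k φ`. -/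
lemma pd_f (n : ℕ) (t : ℝ) (k : Fin 3) (x : EuclideanSpace ℝ (Fin 3)) :
    pd k (f w n t) x = amp w n t * pd k (φ w) x := by
  have : f w n t = fun y => amp w n t * φ w y := rfl
  rw [this, pd_const_mul _ (φ_differentiable w)]

/-- `∂_k f n(t,·) = amp n t · ∂_k φ` as functions. -/
lemma pd_f_fun (n : ℕ) (t : ℝ) (k : Fin 3) : pd k (f w n t) = fun y => amp w n t * dφ w k y := by
  funext x; rw [pd_f]; rfl

/-- `∂_k∂_k f n(t,·) = amp n t · ∂_k∂_k φ`. -/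
lemma pd_pd_f (n : ℕ) (t : ℝ) (k : Fin 3) (x : EuclideanSpace ℝ (Fin 3)) :
    pd k (pd k (f w n t)) x = amp w n t * pd k (pd k (φ w)) x := by
  rw [pd_f_fun, pd_const_mul _ (dφ_differentiable w k)]
  rfl

/-- `∂_t f n(t,x) = R c cos(fr n (t − a)) φ(x)`. -/
lemma hasDerivAt_f (n : ℕ) (x : EuclideanSpace ℝ (Fin 3)) (t : ℝ) :
    HasDerivAt (fun s => f w n s x) (w.R * c w * Real.cos (fr n * (t - w.a)) * φ w x) t := by
  have h1 : HasDerivAt (fun s => fr n * (s - w.a)) (fr n) t := by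
    simpa using ((hasDerivAt_id t).sub_const w.a).const_mul (fr n)
  have h2 : HasDerivAt (fun s => Real.sin (fr n * (s - w.a))) (Real.cos (fr n * (t - w.a)) * fr n) t :=
    h1.sin
  have h3 := (h2.const_mul (w.R * ε w n)).mul_const (φ w x)
  have heq : w.R * ε w n * (Real.cos (fr n * (t - w.a)) * fr n) * φ w x =
      w.R * c w * Real.cos (fr n * (t - w.a)) * φ w x := by
    rw [← ε_mul_fr w n]; ring
  rw [← heq]
  exact h3
/-! ## Membership in `E(K,[a,a+1])` and in the norm-ball of radius `R` -/

/-- `amp n` is `C^∞` as a function on `ℝ × ℝ³`. -/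
lemma amp_contDiff (n : ℕ) : ContDiff ℝ ∞ (fun q : ℝ × EuclideanSpace ℝ (Fin 3) => amp w n q.1) := by
  unfold amp
  exact contDiff_const.mul (Real.contDiff_sin.comp (contDiff_const.mul (contDiff_fst.sub contDiff_const)))

/-- `amp n` is continuous as a function on `ℝ × ℝ³`. -/
lemma amp_continuous (n : ℕ) : Continuous (fun q : ℝ × EuclideanSpace ℝ (Fin 3) => amp w n q.1) :=
  (amp_contDiff w n).continuous

/-- `f n` is jointly `C^∞` in `(t, x)`. -/
lemma f_contDiff_uncurry (n : ℕ) : ContDiff ℝ ∞ (Function.uncurry (f w n)) :=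
  (amp_contDiff w n).mul ((φ_contDiff w).comp contDiff_snd)

/-- The one-sided time derivative of `f n` on `[a, ∞)`. -/
lemma derivWithin_f_Ici (n : ℕ) (x : EuclideanSpace ℝ (Fin 3)) {t : ℝ} (ht : t ∈ Ici w.a) :
    derivWithin (fun s => f w n s x) (Ici w.a) t =
      w.R * c w * Real.cos (fr n * (t - w.a)) * φ w x :=
  (hasDerivAt_f w n x t).hasDerivWithinAt.derivWithin (uniqueDiffOn_Ici w.a t ht)

/-- The one-sided time derivative of `f m − f n` on `[a, ∞)`. -/
lemma derivWithin_f_sub_Ici (m n : ℕ) (x : EuclideanSpace ℝ (Fin 3)) {t : ℝ} (ht : t ∈ Ici w.a) :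
    derivWithin (fun s => f w m s x - f w n s x) (Ici w.a) t =
      w.R * c w * Real.cos (fr m * (t - w.a)) * φ w x - w.R * c w * Real.cos (fr n * (t - w.a)) * φ w x :=
  ((hasDerivAt_f w m x t).sub (hasDerivAt_f w n x t)).hasDerivWithinAt.derivWithin
    (uniqueDiffOn_Ici w.a t ht)

/-! ## The instance `w₁ = (x₀ = 0, r = 1, a = 0, R = 1)`: membership in `X¹` and `‖·‖_{X¹} ≤ 1` -/

/-- The witness data used against the device: bump at the origin, radius `1`, `a = 0`, `R = 1`. -/
def w₁ : W := ⟨0, 1, one_pos, 0, 1, one_pos⟩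

/-- `w₁.a = 0`. -/
lemma w₁_a : w₁.a = 0 := rfl

/-- `w₁.R = 1`. -/
lemma w₁_R : w₁.R = 1 := rfl

/-- Every `f w₁ n` lies in `X¹ = C¹([0,∞), C²(ℝ³))` (skeleton's `InX1`). -/
lemma inX1_f (n : ℕ) : InX1 (f w₁ n) where
  c1 := ((f_contDiff_uncurry w₁ n).of_le one_le_infty).contDiffOn
  c2 := fun t _ => (contDiff_const.mul (φ_contDiff' w₁ 2) : ContDiff ℝ 2 (f w₁ n t))
  cont1 := fun k => by
    have : (fun q : ℝ × EuclideanSpace ℝ (Fin 3) => pd k (f w₁ n q.1) q.2) =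
        fun q => amp w₁ n q.1 * dφ w₁ k q.2 := by
      funext q; rw [pd_f]; rfl
    rw [this]
    exact ((amp_continuous w₁ n).mul ((dφ_contDiff w₁ k).continuous.comp continuous_snd)).continuousOn
  cont2 := fun k => by
    have : (fun q : ℝ × EuclideanSpace ℝ (Fin 3) => pd k (pd k (f w₁ n q.1)) q.2) =
        fun q => amp w₁ n q.1 * pd k (dφ w₁ k) q.2 := by
      funext q; rw [pd_pd_f]; rfl
    rw [this]
    have hc : Continuous (pd k (dφ w₁ k)) := by
      unfold pd
      exact ((dφ_contDiff_one w₁ k).continuous_fderiv one_ne_zero).clm_apply continuous_const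
    exact ((amp_continuous w₁ n).mul (hc.comp continuous_snd)).continuousOn

/-- Every `f w₁ n` has `‖f w₁ n‖_{X¹} ≤ 1` (skeleton's `X1NormLe`, all of `[0,∞) × ℝ³`). -/
lemma x1NormLe_f (n : ℕ) : X1NormLe (f w₁ n) 1 := by
  intro t ht x
  have hεc := ε_le_c w₁ n
  have hc1 := c_le_one w₁
  have hcB := c_mul_B w₁
  have hR : (0 : ℝ) < 1 := one_pos
  have hA := abs_amp_le w₁ n t
  have hφ1 := φ_abs_le_one w₁ x
  have hcos : |Real.cos (fr n * (t - w₁.a))| ≤ 1 := Real.abs_cos_le_one _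
  rw [w₁_R] at hA
  have hε1 : ε w₁ n ≤ 1 := hεc.trans hc1
  have hεB : ε w₁ n * B w₁ ≤ 1 := by
    have h1 : ε w₁ n * B w₁ ≤ c w₁ * B w₁ := mul_le_mul_of_nonneg_right hεc (B_pos w₁).le
    linarith
  have ht' : t ∈ Ici w₁.a := by rw [w₁_a]; exact ht
  refine ⟨?_, ?_, fun k => ⟨?_, ?_⟩⟩
  · have hrw : |f w₁ n t x| = |amp w₁ n t| * |φ w₁ x| := by simp only [f, abs_mul]
    rw [hrw]
    calc |amp w₁ n t| * |φ w₁ x| ≤ 1 * ε w₁ n * 1 :=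
          mul_le_mul hA hφ1 (abs_nonneg _) (mul_nonneg zero_le_one (ε_pos w₁ n).le)
      _ ≤ 1 := by linarith
  · have hI : Ici (0 : ℝ) = Ici w₁.a := by rw [w₁_a]
    rw [hI, derivWithin_f_Ici w₁ n x ht', w₁_R, one_mul]
    calc |c w₁ * Real.cos (fr n * (t - w₁.a)) * φ w₁ x|
        = c w₁ * (|Real.cos (fr n * (t - w₁.a))| * |φ w₁ x|) := by
          rw [abs_mul, abs_mul, abs_of_pos (c_pos w₁), mul_assoc]
      _ ≤ c w₁ * (1 * 1) :=
          mul_le_mul_of_nonneg_left (mul_le_mul hcos hφ1 (abs_nonneg _) zero_le_one) (c_pos w₁).le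
      _ ≤ 1 := by linarith
  · rw [pd_f, abs_mul]
    calc |amp w₁ n t| * |pd k (φ w₁) x| ≤ 1 * ε w₁ n * B w₁ :=
          mul_le_mul hA (abs_pd_φ_le w₁ k x) (abs_nonneg _)
            (mul_nonneg zero_le_one (ε_pos w₁ n).le)
      _ ≤ 1 := by linarith
  · rw [pd_pd_f, abs_mul]
    calc |amp w₁ n t| * |pd k (pd k (φ w₁)) x| ≤ 1 * ε w₁ n * B w₁ :=
          mul_le_mul hA (abs_pd_pd_φ_le w₁ k x) (abs_nonneg _)
            (mul_nonneg zero_le_one (ε_pos w₁ n).le)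
      _ ≤ 1 := by linarith

end Summit.NavierStokesRegularity.NavierStokesRegularity.Theorems.GeorgievDavidi2024

end
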